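import Literature.NumberTheory.EllipticCurves.CastellaHsuKunduLeeLiu2025.SignedBipartiteEulerSystem
import Literature.NumberTheory.EllipticCurves.CastellaWan2024.GreenbergMainConjectureBDP
import Literature.NumberTheory.EllipticCurves.Rank1Residual.Predicates
import Literature.NumberTheory.Automorphic.BrandtGrossPoints
import Literature.NumberTheory.Automorphic.BrandtEigenLine
import HarnessLib

/-!
# CHKLL25 Thm. 7.4 WITH ITS CONSTRUCTION: the signed bipartite system THROUGH Castella–Wan's transfer class, and the
# definite dictionary for `λ±₁(m)` at the trivial character (typing target «P0+P1»; named fact, statement only)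

Topic `NumberTheory/EllipticCurves`, paper directory `CastellaHsuKunduLeeLiu2025/` (sibling of `SignedBipartiteEulerSystem.lean`,
whose Parts 1–6 supply every carrier used here); namespace `Literature.NumberTheory.EllipticCurves.CastellaHsuKunduLeeLiu2025`.
ONE named fact (D-0014; `def … : Prop`, nothing asserted, no `sorry`, no instance, no notation).  It is the
typing target `SpecP0P1` (v2, tree `Summits/BirchSwinnertonDyer/BirchSwinnertonDyer/Cruxes/AnticyclotomicEisensteinDivisibility/Lines/admdef_bridge_spec.lean`
commit 4a03227b4710, LEAD `bsd-line-sbc-p1` g19/g20 of crux stmt-BirchSwinnertonDyer-20727, registered stub `stub_specP0P1`)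
VERBATIM — the JOINT form of three printed statements about ONE class plus the definite-side dictionary, all for the SAME
system `B`, which is why they are one fact (the tree's separate facts `thm74_exists_signedBipartiteSystem` (Part 6 of the
sibling) and `castellaWan2024_proofThm68_transferInputs` pin the system per Heegner family resp. the transfer class
existentially, with no bridge between the two pinnings — module docstring of the sibling, last bullet).

## The print (read at the page; arXiv:2308.10474v2 = [CastellaEtAl2025])

* Thm. 7.4 (Darmon–Iovita, Pollack–Weston), p. 30: under (i) `a_p(E) = 0`, (ii) `p` splits in `K`, (iii) each prime above `p`
  totally ramified in `K_∞/K`, (iv) `(ρ̄, N⁻)` satisfies CR: "for every choice of sign `±` and every `j > 0` there is a pair of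
  systems `κ±_j = {κ±_j(m) ∈ Sel±_{N⁻m}(K, T_j) : m ∈ 𝒩_j^ind}`, `λ±_j = {λ±_j(m) ∈ Λ/℘^jΛ : m ∈ 𝒩_j^def}`, related by … explicit
  reciprocity laws"; (7.2): "For `m = 1`, the classes `κ±_j := κ±_j(1)` … are compatible …, thereby defining the class
  `lim←_j κ±_j ∈ Sel±_{N⁻}(K, T)`"; p. 31 L9–12: "comparing the construction of the classes `κ±_j(m)` in [DI08, §4] and the
  construction of the classes `z_∞[S]±` in [CW24, §4.1], we see that (7.2) is the same as the class `κ±_∞` in (7.1)",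
  (7.1): "`κ±_∞ ∈ 𝒮_±` constructed in [CW24, §4.1] (where it is denoted `z±_∞ = cor_{K[1]/K}(z_∞[1]±)`)".
* §7.3, p. 32 L50–63 with (7.4): to an eigenform `g` of level `M = M⁺M⁻` (`M⁻` square-free product of an odd number of inert
  primes, `a_p(g) ≡ 0 (mod ℘^j)`) one attaches theta elements `Θ±_∞(g/K) ∈ 𝒪⟦Γ⟧` (after [CH18b]) whose square
  `L±_p(g/K) := Θ±_∞(g/K)²` has augmentation `L(g/K,1)/Ω_g^{cong} · η_{g,M⁺,M⁻}^{-1}` "up to a `p`-adic unit", and "from the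
  construction of the elements `λ±_j(m)`, it follows that if `g` is level-raising `f` at `m ∈ 𝒩_j^def`, then the image of
  `Θ±_∞(g/K)` under the map `𝒪⟦Γ⟧ → 𝒪⟦Γ⟧/℘^j𝒪⟦Γ⟧` is the same as `λ±_j(m)`"; Remark 7.3 (the `m`-new level-raised forms
  `g ∈ S₂(Γ₀(Nm))`, [BD05] Thm. 5.15 / [Zha14] Thm. 2.1).
* [CastellaWan2023] (= [CW24] of the source): Prop. 4.1 (the trace-coherent Heegner family at `a_p = 0`), Prop. 4.4 and Def. 4.5
  (the `±` classes `z_∞[S]±`, `z±_∞`), §4.2 (`𝒮_±`, `𝒳_±`), Def. 6.1 / Thm. 6.2 (explicit reciprocity law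
  `ℒ^{BDP}_𝔭` ↔ `z±_∞`), Cor. 6.4, Lemma 6.5 (control), Lemma 6.7, proof of Thm. 6.8 — the transfer inputs FOR THE CLASS `z±_∞`
  with THE BDP `p`-adic `L`-function of the frame (the tree's `AcSigned.TransferInputs … ε z L`, `IsCWBDPLFunction …`, typed in
  `CastellaWan2024/GreenbergMainConjectureBDP.lean` and `AnticyclotomicSignedHeegnerClasses*.lean`).
* [BertoliniDarmon2005] Thm. 5.15 (the level-raised eigenform `f_ℓ : 𝕋 → ℤ/pⁿ` on the definite algebra; its Jacquet–Langlands
  eigenvector), §§2–3 (theta elements from Gross points); [DarmonIovita2008] §2.2 (`L̃_n = Σ_σ g(σ ⋆ v_n) σ⁻¹`, relation (8)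
  `π(L_{n+1}) = −ξ_n L_{n−1}` from `a_p = 0`) and §4 (Props. 4.3, 4.4, 4.6) — the DEFINITE construction behind `λ±_j(m)`.

## The typed statement and its READINGS (documented deltas; nothing silently stronger than print)

Binders = those of the sibling's `thm74_exists_signedBipartiteSystem` (`AcSigned.Setting W K p κ 𝔭 𝔭'` = (i), (ii), `p ∤ h_K` for
(iii), anticyclotomic `κ`; `N = N_E`; `N⁻ = 1` via `SatisfiesHeegnerHypothesis N K`; `(N, D_K) = 1`; `5 ≤ p`; CR = `Surj W p`) plus
those of `castellaWan2024_proofThm68_transferInputs` (a field isomorphism `ι : ℚ̄_p ≃ ℂ` inducing `𝔭`, the newform `f` of `W`, a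
topological generator `γ`, the non-split datum `(h𝔭, γ𝔭, hγ𝔭)` at `𝔭`).  Conclusion: a Castella–Wan BDP frame `(Ω_K ≠ 0, Ω_p, L)`
(`IsCWBDPLFunction`); a trace-coherent Heegner family `F` of level `N` (Prop. 4.1; EXISTENTIAL — flag `heegner-family`); and FOR
EACH SIGN `ε` a class `z ∈ 𝒮_ε` and a system `B` with (a) the laws `IsSignedBipartiteSystem … N ε B` (Thm. 7.4), (b) `z` its limit
base class ((7.2)), (c) `z` the `ε`-signed Heegner class of `F` (p. 31 L9–12 + CW24 Def. 4.5), (d) the transfer inputs of the proof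
of CW24 Thm. 6.8 for `(z, L)`, and (e) the DICTIONARY at `j = 1`: for every `m ∈ 𝒩₁^def` and every definite set-up `S` of type
`(N, m)` there is a non-zero mod-`p` common eigenvector `φ` of the Brandt matrices (`ℓ ∤ Nm`, eigenvalues `a_ℓ(E)`; the reduction
of the Jacquet–Langlands vector of `g_m`, Remark 7.3 / BD05 Thm. 5.15) such that for every Gross point `(ψ, I)` of conductor `1`:
`λ_1(m)` has unit constant coefficient iff the WEIGHTED conductor-`1` toric period `Σ_𝔞 w(x_𝔞) φ(x_𝔞)` is non-zero in `𝔽_p`.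
READINGS: (R1) JOINT PINNING (flag `joint-pinning`): print works with ONE class `κ±_∞ = z±_∞` throughout §7 and CW24 §6; the
tree had no bridge between the per-family pinning (Part 6) and the existential transfer pinning — this fact IS that bridge,
as printed on p. 31 L9–12; (R2) `j = 1` ONLY (weaker than print's "every `j > 0`" for the dictionary; the laws are for all `j`
inside `IsSignedBipartiteSystem`); (R3) DICTIONARY (flag `dictionary-reading`): print states `λ±_j(m) ≡ Θ±_∞(g_m/K) (mod ℘^j)`
(p. 32 L60–63) and the augmentation of `Θ±_∞(g/K)²` as an `L`-VALUE up to a unit ((7.4)); the typed clause reads the augmentation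
of `Θ±_∞(g_m/K)` at the bottom layer of each parity through the CONSTRUCTION of the theta elements from Gross points (BD05 §2,
DI08 §2.2: `L̃_n = Σ_σ g(σ ⋆ v_n) σ⁻¹`, relation (8); LEAD memo gen 19 (F2): `λ⁺_1(m)(𝟙) ≐ ±2·P_K`, `λ⁻_1(m)(𝟙) ≐ ±((p−1)/u_K)·P_K`,
unit multiples for `p ≥ 5`) as "unit ⟺ weighted conductor-`1` period `≠ 0 (mod p)`" — a consequence of a printed sentence and a
definition unfolding, NOT a verbatim printed statement; DI08 itself is MIS-HELD in the literature store at typing time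
(acq-11017), so (R3) rests on CHKLL25 p. 32, BD05 §§2–3 and the LEAD's reading; (R4) WEIGHTS (flag `weighted-toric-period`, LEAD
gen 20 finding F6): the tree's `Brandt.eigenSpace … (Brandt.matrix S.O) …` is the `Matrix.mulVec` (divisor) convention, in
which print's quaternionic eigenFUNCTION is `i ↦ w_i φ_i` (as in the tree's `CaiShuTian2014.thm12_trivialChar`), whence the
weighted period; (R5) the Heegner family `F` is EXISTENTIAL (Castella–Wan's own family; a rescaled family needs a rescaled `L`,
flag `heegner-normalisation` inherited from conjunct 3); (R6) `Ω_p` is typed as a unit of the unramified integers coerced to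
`ℂ_p` (as in the sibling typings).  WEAKER-OR-EQUAL to print in (a)–(d); (e) is the READING (R3)/(R4).  No `_holds` expected
(XL: DI08/PW11 construction + CW24 §§4–6).  No case of BSD, no crux and no stub is proved or asserted by this file.

## References
* [CastellaEtAl2025] F. Castella, C.-Y. Hsu, D. Kundu, Y.-S. Lee, Z. Liu, *Derived p-adic heights and the leading coefficient
  of the Bertolini–Darmon–Prasanna p-adic L-function*, arXiv:2308.10474v2, §7.1 (7.1), §7.2 Remark 7.3, Thm. 7.4, (7.2), p. 31
  L9–12, §7.3 (7.4) and p. 32 L50–63.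
* [CastellaWan2023] F. Castella, X. Wan, *Perrin-Riou's main conjecture for elliptic curves at supersingular primes*, Math. Ann.
  (2023/24), Prop. 4.1, Prop. 4.4, Def. 4.5, §4.2, Def. 6.1, Thm. 6.2, Cor. 6.4, Lemma 6.5, Lemma 6.7, Thm. 6.8.
* [DarmonIovita2008] H. Darmon, A. Iovita, *The anticyclotomic main conjecture for elliptic curves at supersingular primes*,
  J. Inst. Math. Jussieu 7 (2008), §2.2, §4 (Props. 4.3, 4.4, 4.6).
* [BertoliniDarmon2005] M. Bertolini, H. Darmon, Ann. of Math. 162 (2005), p. 18, §§2–3, Thm. 5.15.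
* [PollackWeston2011] R. Pollack, T. Weston, Compos. Math. 147 (2011), §4.3.
-/

noncomputable section

open scoped Classical
open NumberField IsDedekindDomain Field
open Literature.NumberTheory.EllipticCurves Literature.NumberTheory.EllipticCurves.ModularForms
  Literature.NumberTheory.EllipticCurves.Rank1Residual Literature.NumberTheory.EllipticCurves.CastellaWan2024
  Literature.NumberTheory.EllipticCurves.AcSigned Literature.NumberTheory.EllipticCurves.BertoliniDarmon2005
  Literature.NumberTheory.GaloisRepresentations Literature.NumberTheory.Automorphic

namespace Literature.NumberTheory.EllipticCurves.CastellaHsuKunduLeeLiu2025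

/-- **Castella–Hsu–Kundu–Lee–Liu 2025, Thm. 7.4 WITH ITS CONSTRUCTION ((7.1) = (7.2), Castella–Wan's transfer inputs for that
class, and the definite dictionary for `λ±₁(m)` at the trivial character) — typing target «P0+P1» (`SpecP0P1` v2, verbatim).**
Printed: Thm. 7.4 "for every choice of sign `±` and every `j > 0` there is a pair of systems `κ±_j`, `λ±_j` related by … explicit
reciprocity laws"; (7.2) "`lim←_j κ±_j ∈ Sel±_{N⁻}(K, T)`"; p. 31 "(7.2) is the same as the class `κ±_∞` in (7.1)" = "`z±_∞ =
cor_{K[1]/K}(z_∞[1]±)` constructed in [CW24, §4.1]"; p. 32 "if `g` is level-raising `f` at `m ∈ 𝒩_j^def`, then the image of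
`Θ±_∞(g/K)` … modulo `℘^j` is the same as `λ±_j(m)`".  TYPED (binders of `thm74_exists_signedBipartiteSystem` ∪ those of
`castellaWan2024_proofThm68_transferInputs`): there are a BDP frame `(Ω_K ≠ 0, Ω_p, L)`, a trace-coherent Heegner family `F` of
level `N`, and for each sign `ε` a class `z ∈ 𝒮_ε` and a system `B` with the laws, `z` its limit base class, `z` the `ε`-signed
Heegner class of `F`, the transfer inputs for `(z, L)`, and — for every `m ∈ 𝒩₁^def`, every definite set-up `S` of type `(N, m)` —
a non-zero mod-`p` Brandt eigenvector `φ` for `a_ℓ(E)` (`ℓ ∤ Nm`) with `IsUnit (λ_1(m)(0)) ↔ Σ_𝔞 w(x_𝔞) φ(x_𝔞) ≠ 0` at every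
conductor-`1` Gross point.  READINGS (R1)–(R6) of the module docstring (joint pinning; `j = 1`; the dictionary is a READING of
p. 32 L50–63 through the Gross-point construction of the theta elements, weighted period in the `mulVec` convention; `F`
existential).  A NAMED FACT; no `_holds` expected.
[cite: CastellaEtAl2025, Thm. 7.4, (7.1)–(7.2), §7.2 p. 31 L9–12, Remark 7.3, §7.3 (7.4) and p. 32 L50–63 (arXiv:2308.10474v2 pp. 29–32)]
[cite: CastellaWan2023, Prop. 4.1, Prop. 4.4, Def. 4.5, Thm. 6.2, Lemma 6.5, Lemma 6.7, proof of Thm. 6.8]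
[cite: DarmonIovita2008, §2.2 and §4 (Prop. 4.3, 4.4, 4.6)] [cite: BertoliniDarmon2005, Thm. 5.15 and §§2–3] [cite: PollackWeston2011, §4.3] -/
def thm74_eq72_exists_signedSystem_transferClass_dictionary : Prop :=
  ∀ (N : ℕ) [NeZero N] (W : WeierstrassCurve ℚ) [W.IsGloballyMinimal] (K : Type) [Field K] [NumberField K]
    (p : ℕ) [Fact p.Prime] (κ : ZpExtension K p) (𝔭 𝔭' : HeightOneSpectrum (𝓞 K))
    (hS : Setting W K p κ 𝔭 𝔭') (ι : PadicAlgCl p ≃+* ℂ) {f : CuspForm (CongruenceSubgroup.Gamma0 N) 2} (_ : IsNewformOf W f),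
    (W.conductorNorm ℤ : ℕ) = N → SatisfiesHeegnerHypothesis N K → IsCoprime (N : ℤ) (NumberField.discr K) → 5 ≤ p →
    Surj W p → (∀ (w : InfinitePlace K) (k : 𝓞 K), k ∈ 𝔭.asIdeal ↔ ‖ι.symm (w.embedding (k : K))‖ < 1) →
    ∀ (γ : absoluteGaloisGroup K) (hγ : κ.IsTopGenerator γ) (h𝔭 : IsNonsplitIn κ 𝔭)
      (γ𝔭 : absoluteGaloisGroup (𝔭.adicCompletion K))
      (hγ𝔭 : κ (resGalOfEmb (closureEmb (K := K) (𝔭.adicCompletion K)) γ𝔭) = κ γ),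
      ∃ (ΩK : ℂ) (Ωp : (unrIntegers p)ˣ) (L : UnrSeries p), ΩK ≠ 0 ∧
        IsCWBDPLFunction ι 𝔭 κ γ f (NumberField.discr K) ΩK ((Ωp : unrIntegers p) : ℂ_[p]) L ∧
        ∃ (jbar : AlgebraicClosure K →+* ℂ) (F : HeegnerFamily N W K κ jbar), F.IsTraceCoherentApZero ∧
          ∀ ε : ℤˣ, ∃ (z : selmerLambdaAdic (W.baseChange K) p κ γ (fun _ ↦ .sgn ε))
            (B : SignedBipartiteSystem W K p κ),
            IsSignedBipartiteSystem W K p κ γ N ε B ∧ B.IsLimitBaseClass z.1 ∧ IsSignedHeegnerClass p κ γ F ε z.1 ∧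
            TransferInputs (W.baseChange K) p κ γ hγ 𝔭 h𝔭 γ𝔭 hγ𝔭 𝔭' (fun h ↦ hS.ne h.symm) hS.mem ε z L ∧
            -- DICTIONARY at `j = 1`: `λ_1(m)(0)` is a unit iff the WEIGHTED conductor-1 toric period `Σ_𝔞 w(x_𝔞) φ(x_𝔞)` of the JL eigenvector is non-zero mod `p` [v2]
            ∀ m ∈ defProducts N K (fun ℓ ↦ W.frobeniusTrace ℓ) p 1, ∀ (S : Brandt.XiSetup N m),
              ∃ φ : Brandt.ClassSet S.O → ZMod p, φ ≠ 0 ∧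
                (letI : Fintype (Brandt.ClassSet S.O) := Fintype.ofFinite _
                 φ ∈ Brandt.eigenSpace (ZMod p) (N * m) (Brandt.matrix S.O) (fun ℓ ↦ W.frobeniusTrace ℓ)) ∧
                ∀ (ψ : K →ₐ[ℚ] S.D) (I : Submodule ℤ S.D), Brandt.IsGrossPoint S.O ψ I →
                  (IsUnit (PowerSeries.constantCoeff (B.lam 1 m)) ↔
                    Brandt.toricPeriod S.O ψ I (fun i ↦ (Brandt.weight S.O i : ZMod p) * φ i) ≠ 0)


end Literature.NumberTheory.EllipticCurves.CastellaHsuKunduLeeLiu2025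

end
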